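import Summits.QuantumFields.YangMills.Theorems.LuscherReductionDressedRitzPolyakovLiftStaticsOfLeakage
import Summits.QuantumFields.YangMills.Theorems.LuscherReductionDressedRitzPolyakovLiftBasisGenericL
import HarnessLib

/-!
# Line «polyakovlift» r7 on crux `DressedRitz` (stmt-QuantumFields-20205): S-STAT from S-LEAK♯ ∧ UNIVERSALITY ∧ one-site shadow position
# (the statics stub's distinct-level pairs CONSUME the registered universality text by name)

Fleet-service module of seat ym-infvol-p1 g8 (count-neutral, `--supports stmt-QuantumFields-20205`), sequel of `…PolyakovLiftStaticsOfLeakage`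
(`staticsForLR_of_leakagePositionCert`: sharp (o4) + (o5) ∀-basis + ONE ⟹ (o2) for distinct-level pairs).  Here the ∀-basis fine POSITION input (o5)
is produced, channel by channel, from the REGISTERED universality text `ChannelUniversalityForL (TransplantBasisLR k)` (= level `k` of the line's
`stub_universality`, clause (A5)) and a ONE-SITE ∀-basis shadow position (clauses (o0′)(o5′) of `PScalingExistsForL` for EVERY r7 basis, not just
the one the line's PSCALING″ supplies), by the tree's pure-real `o5_transfer` at the Perron–Frobenius one-site vacuum — exactly as in the LEAD's
`liftPositionForL_of_channelUniversality_pscaling`.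

* ★★ `staticsForLR_of_leakage_universality_shadowPosition k` — `StaticsForL (TransplantBasisLR k)` from: (S-LEAK♯) sharp single-state dominance at rate
  `λ⁴/L²` ∀ channels of every r7 basis; (U) `ChannelUniversalityForL (TransplantBasisLR k)`; (SH-POS∀) one-site (o0′)(o5′) for the shadow of every r7 basis
  at `B = 2L³/Λ³`; (DEG) per pair `PairSeparated (g i) (g l) ∨ physLevel (i+2) ≠ physLevel (l+2)` for every r7 basis.

READING (r8 design option, by name): given UNIVERSALITY, the statics stub at level `k` is implied by a SHARPENED leakage stub (rate `λ⁴` for `λ³`), a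
ONE-SITE ∀-basis position statement (no renormalisation group) and the degenerate-pair certificate — one fewer independent RG deliverable for the pairs in
distinct one-site levels.  HONEST FRAMING: composition only; none of the four inputs is proved here; conditional femto rung R2b1; not infinite volume,
not a gap, not Clay.  References: M. Lüscher, NPB 219 (1983) 233 [cite: Luscher1983, §3]; M. Lüscher, U. Wolff, NPB 339 (1990) 222 [cite: LuscherWolff1990];
C. Davis, W. M. Kahan, SIAM J. Numer. Anal. 7 (1970) 1 [cite: DavisKahan1970, §2].
-/

set_option autoImplicit false

noncomputable section

open MeasureTheory Filter Topology Real
open Literature.MathematicalPhysics.QuantumFieldTheory (GaugeConfig Site gaugeTransform)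
open Literature.Analysis.OperatorTheory.YMMatrixModel
open scoped BigOperators

namespace Summit.QuantumFields.YangMills.Theorems.FemtoTransferGap.PolyakovLift

open Summit.QuantumFields.YangMills.Theorems.FemtoTransferGap

/-- ★★ **S-STAT at level `k` from S-LEAK♯ ∧ UNIVERSALITY ∧ one-site ∀-basis shadow position ∧ degenerate-pair certificate.** [cite: Luscher1983, §3]
[cite: LuscherWolff1990] [cite: DavisKahan1970, §2] -/
theorem staticsForLR_of_leakage_universality_shadowPosition (k : ℕ)
    (hleak : ∃ C₄ lam1 : ℝ, 0 ≤ C₄ ∧ 0 < lam1 ∧ ∀ lam : ℝ, 0 < lam → lam ≤ lam1 → ∃ L0 : ℕ,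
      ∀ (L : ℕ) [NeZero L], L0 ≤ L → ∀ β : ℝ, InFemtoWindow lam β L → ∀ φ : GaugeConfig 3 L SU2 → ℝ, IsRawVacuum β φ →
        ∀ g : Fin k → (Cfg → ℝ), TransplantBasisLR k L (luscherLambda β L) g →
          ∀ i : Fin k,
            l2 (transferApply β (dressedLiftFamily β φ g i)) (transferApply β (dressedLiftFamily β φ g i)) *
                  l2 (dressedLiftFamily β φ g i) (dressedLiftFamily β φ g i) -
                l2 (dressedLiftFamily β φ g i) (transferApply β (dressedLiftFamily β φ g i)) ^ 2
              ≤ C₄ * (luscherLambda β L ^ 4 / (L : ℝ) ^ 2) * levelValue su2Rep L β 0 ^ 2 *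
                  l2 (dressedLiftFamily β φ g i) (dressedLiftFamily β φ g i) ^ 2)
    (hU : ChannelUniversalityForL (TransplantBasisLR k))
    (hshadow : ∃ CB lam2 : ℝ, 0 ≤ CB ∧ 0 < lam2 ∧ ∀ lam : ℝ, 0 < lam → lam ≤ lam2 → ∃ L0 : ℕ, ∀ L : ℕ, L0 ≤ L →
      ∀ Λ : ℝ, lam ≤ Λ → Λ ≤ 2 * lam →
        ∀ e₀ : GaugeConfig 3 1 SU2 → ℝ, IsRawVacuum (L := 1) (2 * (L : ℝ) ^ 3 / Λ ^ 3) e₀ →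
          ∀ g : Fin k → (GaugeConfig 3 1 SU2 → ℝ), TransplantBasisLR k L Λ g →
            let B : ℝ := 2 * (L : ℝ) ^ 3 / Λ ^ 3
            let w : Fin k → (GaugeConfig 3 1 SU2 → ℝ) := shadowFamily B L e₀ g
            let m0 := levelValue su2Rep 1 B 0
            (∀ i : Fin k, 0 < l2 (w i) (w i)) ∧
            (∀ i : Fin k,
              l2 (w i) (transferApply B (w i)) * m0 ≤ Real.exp (CB * Λ ^ 2 / L) * (levelValue su2Rep 1 B ((i : ℕ) + 1) * m0) * l2 (w i) (w i) ∧
              levelValue su2Rep 1 B ((i : ℕ) + 1) * m0 * l2 (w i) (w i) ≤ Real.exp (CB * Λ ^ 2 / L) * (l2 (w i) (transferApply B (w i)) * m0)))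
    (hdeg : ∀ (L : ℕ) (Λ : ℝ) (g : Fin k → (Cfg → ℝ)), TransplantBasisLR k L Λ g →
      ∀ i l : Fin k, i ≠ l → PairSeparated (g i) (g l) ∨ physLevel ((i : ℕ) + 2) ≠ physLevel ((l : ℕ) + 2)) :
    StaticsForL (TransplantBasisLR k) := by
  obtain ⟨C₄, lam1, hC₄, hlam1, hK⟩ := hleak
  obtain ⟨CA, lA, hCA, hlA, hAk⟩ := hU
  obtain ⟨CB, lB, hCB, hlB, hBk⟩ := hshadow
  refine staticsForLR_of_leakagePositionCert k ⟨C₄, CA + CB, min lam1 (min lA lB), hC₄, by positivity, lt_min hlam1 (lt_min hlA hlB),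
    fun lam hlam hle => ?_⟩
  obtain ⟨LK, hLK⟩ := hK lam hlam (hle.trans (min_le_left _ _))
  obtain ⟨LA, hLA⟩ := hAk lam hlam (hle.trans ((min_le_right _ _).trans (min_le_left _ _)))
  obtain ⟨LB, hLB⟩ := hBk lam hlam (hle.trans ((min_le_right _ _).trans (min_le_right _ _)))
  refine ⟨max LK (max LA LB), fun L _ hL β hW φ hφ g hbasis => ?_⟩
  have hleK : LK ≤ L := (le_max_left _ _).trans hL
  have hleA : LA ≤ L := ((le_max_left _ _).trans (le_max_right _ _)).trans hL
  have hleB : LB ≤ L := ((le_max_right _ _).trans (le_max_right _ _)).trans hL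
  have hβ0 : 0 ≤ β := zero_le_one.trans hW.1
  have hΛpos : 0 < luscherLambda β L := luscherLambda_pos_of_window hlam hW
  have hLpos : (0 : ℝ) < L := Nat.cast_pos.mpr (NeZero.pos L)
  have hBpos : 0 < oneSiteCoupling β L := by
    unfold oneSiteCoupling; exact div_pos (mul_pos two_pos (pow_pos hLpos 3)) (pow_pos hΛpos 3)
  obtain ⟨e₀, θ, c, he₀, -, -, hn₀, heig₀, -, -, -⟩ := PhysL2.exists_groundState (L := 1) (oneSiteCoupling β L)
  have heig₀' : transferApply (oneSiteCoupling β L) e₀ = levelValue su2Rep 1 (oneSiteCoupling β L) 0 • e₀ := by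
    rw [levelValue_zero]; exact heig₀
  have hvac₀ : IsRawVacuum (L := 1) (oneSiteCoupling β L) e₀ := ⟨he₀, hn₀, heig₀'⟩
  obtain ⟨hB0, hB5⟩ := hLB L hleB (luscherLambda β L) hW.2.1 hW.2.2 e₀ hvac₀ g hbasis
  obtain ⟨hA5, -⟩ := hLA L hleA β hW φ hφ g hbasis e₀ hvac₀
  have hm0pos : 0 < levelValue su2Rep 1 (oneSiteCoupling β L) 0 := levelValue_su2Rep_pos (L := 1) hBpos 0
  have hl0nn : 0 ≤ levelValue su2Rep L β 0 := levelValue_su2Rep_nonneg L hβ0 0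
  have hEA : 0 < Real.exp (CA * luscherLambda β L ^ 2 / L) := Real.exp_pos _
  have hEB : 0 < Real.exp (CB * luscherLambda β L ^ 2 / L) := Real.exp_pos _
  have hEE : Real.exp (CA * luscherLambda β L ^ 2 / L) * Real.exp (CB * luscherLambda β L ^ 2 / L) =
      Real.exp ((CA + CB) * luscherLambda β L ^ 2 / L) := by
    rw [← Real.exp_add]; congr 1; ring
  refine ⟨hLK L hleK β hW φ hφ g hbasis, fun i => ?_, hdeg L _ g hbasis⟩
  obtain ⟨h1, h2⟩ := o5_transfer (hB0 i) hm0pos (l2_self_nonneg (dressedLiftFamily β φ g i)) hl0nn hEA hEB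
    (hA5 i).1 (hA5 i).2 (hB5 i).1 (hB5 i).2
  rw [hEE] at h1 h2
  exact ⟨h1, h2⟩

end Summit.QuantumFields.YangMills.Theorems.FemtoTransferGap.PolyakovLift

end
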